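import Summits.BirchSwinnertonDyer.BirchSwinnertonDyer.Theorems.KolyvaginRoadThreeCruxIffLeaf
import Summits.BirchSwinnertonDyer.BirchSwinnertonDyer.Theorems.KolyvaginRoadThreeMethod2OddSelmerRank
import Summits.BirchSwinnertonDyer.Rank1Residual.X11b.Three.ClassRecordAtThree
import Summits.BirchSwinnertonDyer.Rank1Residual.X11b.Three.KolyvaginLine
import Summits.BirchSwinnertonDyer.Rank1Residual.X11b.RingClassFieldNoTorsion
import Literature.NumberTheory.EllipticCurves.BSDSelmerCMPConverseRankOneProofs
import HarnessLib

/-!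
# Route `KolyvaginRoadThree`, deciding crux `ZhangSharpFrameAtThreeHL` (item stmt-BirchSwinnertonDyer-19574),
# registered skeleton v2y (plan g28, 83f4d996fa6b6988), stub S1 `stub_bottomRankOneAtThree`: the CONDUCTOR-ONE
# Kolyvagin class `c(1) = δ(y_K) mod 3` is non-zero on the slice `dim_𝔽₃ Sel₃(E/K) = 1` — from `BSD(E,3)` on every
# HL frame, hence on A1 ∩ NON-SPLIT(3) from Schneider's non-degeneracy at the pair
# (cell `bsd-stepL`, ACCEL seat `bsd-stepL-koly3b` g3; `--supports stmt-BirchSwinnertonDyer-19574`, helper)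

HONEST FRAMING. BSD is not proved by any of this; Kolyvagin's conjecture mod 3 is asserted nowhere; Schneider's
conjecture (`ClassClosure.RegulatorNonvanishingAt W 3` class-wide = crux `ClassRecordThree.SchneiderAtThree`, item
19106) is asserted nowhere; every published input is a named fact of the tree taken as a BINDER. THEOREMS ONLY
(0 definitions, 0 named facts, 0 `sorry`). PARTITION: O2@3 (B10) × A1 ∩ {dim_𝔽₃ Sel₃(E/K) = 1} — types-the-object-of;
closes: none (the registered stub S1 carries NO published-input binders, so it is concluded here only CONDITIONALLY;
T7).

THE POINT (plan g28 01:08:28Z: «cheap extra brick if g0's Schneider proof produced n = 1 internally»). It did not: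
zhang3-p1's converse `Koly.kolyvaginClass_one_ne_zero_of_bsdp_of_hlFrame` (p431973) returns SOME Kolyvagin conductor
`n` (McCallum Cor. 5.6 with `M_∞ ≥ 1`), and so do koly3b g0's p456367 ∕ p459573 on the non-split slice. Stub S1 of
v2y pins `n = 1`. On S1's slice the sharper statement holds and needs LESS print: with `dim_𝔽₃ Sel₃(E/K) = 1`,
`rank E(K) = 1` (Kolyvagin on the HL frame) and `E(K)[3] = 0` (irreducibility over `K`), the exact sequence
`0 → E(K)/3 → Sel₃(E/K) → Ш(E/K)[3] → 0` (`natCard_selmerGroup_eq`) forces `Ш(E/K)[3^∞] = 0`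
(`primaryComponent_sha_eq_bot_of_card_selmerGroup_eq`); STEP L from `BSD(E,3)`
(`indexLowerBoundAt_of_bsdp_of_heegnerData_of_odd`: `2·ord₃[E(K):ℤy_K] ≤ ord₃ #Ш(E/K) + 2·ord₃∏c = 0` on A1) then
gives `3 ∤ [E(K):ℤy_K]`, i.e. `y_K ∉ 3E(K)` (McCallum Lemma 5.1, `padicValNat_index_zmultiples_eq_of_divisibility`);
Gross's `P(1) = y_K` (`KolyvaginBottom.eq_of_map_eq_heegnerPointComplex`, Shimura reciprocity at conductor 1) and
`E(K[1])[3] = 0` (Gross Lemma 4.3, `eq_zero_of_zsmul_pow_eq_zero_ringClassField`) transport this to `P(1) ∉ 3E(K[1])`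
(`pDiv_one_iff_exists_zsmul_eq`), and the tower theorem at conductor 1 (`KolyCert.kolyvaginClass_three_ne_zero_of_
tower_not_pDiv`, McCallum Cor. 4.5 ∕ Gross Prop. 3.6) makes `c₁(1) ≠ 0`. NO use of McCallum Cor. 5.6 (neither half).

* §1 `Koly.kolyvaginClass_conductorOne_ne_zero_of_bsdp_of_finrank_selmer_eq_one` — ONE curve, ONE HL frame: PUB
  (Gross–Zagier, Kolyvagin, Skinner 2016 Thm. C, GZK, modularity, Shimura reciprocity at conductor 1, Gross 1991 §3 ×2)
  + A1 + `dim_𝔽₃ Sel₃(E/K) = 1` + `BSDp W 3` ⟹ `∃ d : KolyvaginHeegnerData Dt β ι 1, c₁(1) ≠ 0` — S1's conclusion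
  VERBATIM from the leaf at the pair (every frame, split or not).
* §2 `Koly.kolyvaginClass_conductorOne_ne_zero_of_nonsplit_of_regulatorNonvanishingAt` — the same on A1 ∩ NON-SPLIT(3)
  with `BSDp W 3` replaced by road (a) of the class record (Skinner 2016 Thm. A + Stein–Wuthrich Thm. 6.1 ∕ §4.2 +
  Disegni 2020 Thm. 1 + GZK + parametrisations, `X11b.Three.bsdp_of_ram_of_nonsplit_of_regulatorNonvanishing`) and the
  ONE open per-pair input `ClassClosure.RegulatorNonvanishingAt W 3` (Schneider at the pair; class-wide on A1 = item
  19106 restricted to A1 — NOT the KOLY residual `SchneiderTamAtThree`, which is typed OFF A1 (`3 ∣ ∏c`)).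
* §3 `Koly.BottomRankOne.stub_bottomRankOneAtThree_of_bsdp_onA1` ∕ `…_nonsplit_of_schneider_onA1` — the registered S1 signature
  with its binders VERBATIM as conclusion shape, from PUB (as ∀-binders) + «BSD₃ on A1» resp. + non-split +
  «Schneider on A1 ∩ non-split».

References: [cite: McCallumLMS1991, §4 (5), Cor. 4.5, §5 Lemma 5.1 (p. 303)] [cite: GrossLMS1991, §3, Prop. 3.6,
Lemma 4.3, §4 (P_1 = y_K)] [cite: WZhang2014, Thm. 9.1 (r = 1), Remark 5, Thm. 10.2] [cite: SilvermanAEC2009, Thm. X.4.2]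
[cite: Skinner2016PacificMC, Thm. A, §3.2] [cite: SteinWuthrich2013, Thm. 6.1, §4.2] [cite: Disegni2020, Thm. 1]
[cite: BurungaleTian2019, proof of Cor. 1.4 (the `#Sel_p = p ⇒ Ш[p^∞] = 0` step)].
-/

noncomputable section

open scoped Classical

namespace Summit.BirchSwinnertonDyer.Rank1Residual.X11b.Three.Koly

open WeierstrassCurve NumberField Literature.NumberTheory.EllipticCurves
  Literature.NumberTheory.EllipticCurves.ModularForms
  Literature.NumberTheory.EllipticCurves.Rank1Residual
  Literature.NumberTheory.EllipticCurves.Skinner2016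
  Literature.NumberTheory.EllipticCurves.SteinWuthrich2013
  Literature.NumberTheory.EllipticCurves.Disegni2020
  Summit.BirchSwinnertonDyer.Rank1Residual Summit.BirchSwinnertonDyer.Rank1Residual.X11b Module

/-! ## §1 One curve, one HL frame: `BSD(E,3)` + `dim_𝔽₃ Sel₃(E/K) = 1` ⟹ `c₁(1) ≠ 0` -/

/-- **The conductor-one Kolyvagin class mod 3 is non-zero on the slice `dim_𝔽₃ Sel₃(E/K) = 1`, granted `BSD(E,3)`.**
Data: `W/ℚ` globally minimal with `(E,3) ∈ X11b`, a (ram) witness and `3 ∤ ∏c_ℓ(E)`; `K` imaginary quadratic with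
`d_K` odd, Heegner for `N_E`, `L(E^{d_K},1) ≠ 0`; a frame `(Dt, β, ι)` with `4N ∣ β² − d_K` and `3 ∤ c(Dt)`; the
`ZMod 3`-structure of `H¹(K, E[3])` as an instance binder (as in the registered stub). PUBLISHED inputs as binders:
Gross–Zagier `hGZ`, Kolyvagin `hKo`, Skinner 2016 Thm. C `hSk`, GZK `hGZK`, modularity `hmod`, Shimura reciprocity at
conductor 1 `hrec`, Gross 1991 §3 `h1 h2`. HYPOTHESES: `dim_𝔽₃ Sel₃(E/K) = 1` and `BSDp W 3`. CONCLUSION: some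
Kolyvagin–Heegner datum of CONDUCTOR 1 on the frame has `c₁(1) ≠ 0` (for every such datum `c₁(1) = δ(P(1)) = δ(y_K)`).
Mechanism in the module docstring: `Ш(E/K)[3^∞] = 0`, STEP L ⟹ `3 ∤ [E(K):ℤy_K]`, Gross's `P(1) = y_K` and
`E(K[1])[3] = 0` ⟹ `P(1) ∉ 3E(K[1])`, tower theorem at conductor 1. CONDITIONAL on every binder; nothing is booked.
[cite: McCallumLMS1991, §5 Lemma 5.1, §4 Cor. 4.5] [cite: GrossLMS1991, Lemma 4.3, §4] [cite: SilvermanAEC2009, Thm. X.4.2] -/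
theorem kolyvaginClass_conductorOne_ne_zero_of_bsdp_of_finrank_selmer_eq_one
    (W : WeierstrassCurve ℚ) [W.IsElliptic] [W.IsGloballyMinimal] [NeZero (W.conductorNorm ℤ)]
    (K : Type) [Field K] [NumberField K]
    (Dt : ModularParametrizationData W (W.conductorNorm ℤ)) (β : ℤ) (ι : K →+* ℂ)
    -- published inputs (named facts of the tree)
    (hGZ : gross_zagier (W.conductorNorm ℤ) W K) (hKo : kolyvagin (W.conductorNorm ℤ) W K)
    (hSk : Skinner2016.thmC_padicValRat_bsd_rank_zero)
    (hGZK : rank_eq_analyticRank_of_analyticRank_le_one) (hmod : hasEntireLFunction_rat)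
    (hrec : heegnerPointOfConductor_one_galoisConj (W.conductorNorm ℤ) W K)
    (h1 : phi_heegnerPointOfConductor_mem_range_map_ringClassField (W.conductorNorm ℤ) W K)
    (h2 : exists_generator_ringClassGalOver K)
    -- the pair (A1) and the HL frame
    (hX : ClassX11b W 3) (hram : Ram W 3) (htam : ¬ 3 ∣ W.tamagawaProduct)
    (hK : IsImaginaryQuadratic K) (hodd : Odd (NumberField.discr K))
    (hH : SatisfiesHeegnerHypothesis (W.conductorNorm ℤ) K)
    (hLt : (W.quadraticTwist (NumberField.discr K : ℚ)).entireLFunction 1 ≠ 0)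
    (hβ : (4 * (W.conductorNorm ℤ : ℤ)) ∣ β ^ 2 - NumberField.discr K) (hc : ¬ (3 : ℤ) ∣ Dt.c)
    [Module (ZMod 3) (Method2.V3 W K)]
    -- the slice: dim_𝔽₃ Sel₃(E/K) = 1
    (h1dim : finrank (ZMod 3)
      (AddSubgroup.toZModSubmodule 3 (selmerGroup (W.baseChange K) ((3 ^ 1 : ℕ) : ℤ))) = 1)
    -- the hypothesis: the 3-part of BSD for E/ℚ
    (hbsd : BSDp W 3) :
    ∃ d : KolyvaginHeegnerData Dt β ι 1, d.kolyvaginClass Nat.prime_three 1 ≠ 0 := by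
  haveI : Fact (Nat.Prime 3) := ⟨Nat.prime_three⟩
  have hmult : W.HasMultiplicativeReductionAtPrime 3 := hX.2.2.1
  have hirr : Irr W 3 := hX.2.2.2
  have hρ : Surj W 3 := surj_of_irr_of_ram W 3 hirr hram
  -- `3 ∤ d_K`, `3 ∤ #𝓞_K^×`, `d_K < 0`
  obtain ⟨_, hμ⟩ := not_dvd_discr_and_not_dvd_torsionOrder_of_heegner hK hH (p := 3) (by decide)
    (dvd_conductorNorm_of_classX11b hX)
  have hDneg : NumberField.discr K < 0 := by
    have hND : IsCoprime (W.conductorNorm ℤ : ℤ) (NumberField.discr K) := by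
      have h := Literature.SatisfiesHeegnerHypothesis.coprime_discr hK.1 hH
      refine Int.isCoprime_iff_gcd_eq_one.mpr ?_
      rw [Int.gcd_eq_natAbs, Int.natAbs_natCast]
      exact h
    have hlt := discr_lt_neg_four_of_isCoprime_of_dvd_sq_sub hK hND (dvd_conductorNorm_of_classX11b hX) hβ
    omega
  -- an oriented Heegner datum `H` with `H.β = β`, and THE Heegner point `P = y_K ∈ E(K)` of the frame
  obtain ⟨H, hHβ⟩ := exists_heegnerDatum (W.conductorNorm ℤ) hDneg hβ
  obtain ⟨P, hP⟩ := heegnerPointComplex_mem_range_map_holds (W.conductorNorm ℤ) W K hK hH Dt H ι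
  -- a globally minimal model of the quadratic twist by `d_K`
  have hD0 : (NumberField.discr K : ℚ) ≠ 0 := by exact_mod_cast NumberField.discr_ne_zero K
  haveI hEt : (W.quadraticTwist (NumberField.discr K : ℚ)).IsElliptic := W.isElliptic_quadraticTwist hD0
  obtain ⟨Cd, hCd⟩ := hasGlobalMinimalModel_rat_holds (W.quadraticTwist (NumberField.discr K : ℚ))
  haveI := hCd
  -- STEP L at `P` from `BSD(E,3)`
  have hL : IndexLowerBoundAt W 3 K P :=
    indexLowerBoundAt_of_bsdp_of_heegnerData_of_odd W 3 K Dt H ι P hGZ hKo hSk hGZK hmod hX hram hK hodd hH hP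
      (by exact_mod_cast hc) hμ hLt (Cd • W.quadraticTwist (NumberField.discr K : ℚ)) Cd rfl hbsd
  -- arithmetic of `E(K)`: `y_K` non-torsion (GZ), rank one and `Ш` finite (Kolyvagin), no 3-torsion, `3^{M₀} ∥ y_K`
  have hPinf : ¬ IsOfFinAddOrder P :=
    not_isOfFinAddOrder_of_heegner_of_analyticRank_eq_one W (W.conductorNorm ℤ) K Dt H ι P hGZ hmod hX.1 hK hH
      hLt hP
  obtain ⟨hrank, hSha⟩ := hKo hK hH ⟨Dt, H, ι, hP⟩ hPinf
  haveI : Finite (W.baseChange K).sha := hSha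
  have hbot := torsionBy_eq_bot_of_isImaginaryQuadratic_of_hasIrreducibleModPGaloisRep W K hK Nat.prime_three hirr
  have hiv : ∀ x : (W.baseChange K).toAffine.Point, 3 • x = 0 → x = 0 := fun x hx ↦ by
    have hmem : x ∈ AddSubgroup.torsionBy (W.baseChange K).toAffine.Point ((3 : ℕ) : ℤ) := by
      rw [mem_torsionBy_iff, natCast_zsmul]
      exact hx
    rw [hbot] at hmem
    exact hmem
  haveI : Module.Finite ℤ (W.baseChange K).toAffine.Point := (W.baseChange K).module_finite_point_holds
  obtain ⟨M₀, x₀, hx₀, hmax⟩ := exists_pow_smul_eq_and_forall_ne hPinf (p := 3) (by norm_num)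
  have hdiv : ∃ Q : (W.baseChange K).toAffine.Point, ((3 ^ M₀ : ℕ) : ℤ) • Q = P :=
    ⟨x₀, by rw [natCast_zsmul]; exact hx₀⟩
  have hndiv : ¬ ∃ Q : (W.baseChange K).toAffine.Point, ((3 ^ (M₀ + 1) : ℕ) : ℤ) • Q = P := by
    rintro ⟨Q, hQ⟩
    exact hmax Q (by rw [← natCast_zsmul]; exact hQ)
  -- the two bridges: `ord₃ [E(K):ℤP] = M₀` (McCallum Lemma 5.1) and `ord₃ #Ш = ord₃ #Ш[3^∞]`
  haveI : Finite (AddCommGroup.torsion (W.baseChange K).toAffine.Point) :=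
    WeierstrassCurve.finite_torsion_point (W := W.baseChange K)
  obtain ⟨cc, Q, hcQ, hcker⟩ := RankOne.exists_coord_of_mordellWeilRank_eq_one (W.baseChange K) hrank
  have hidx : padicValNat 3 (AddSubgroup.zmultiples P).index = M₀ :=
    padicValNat_index_zmultiples_eq_of_divisibility cc Q hcQ hcker hiv P hdiv hndiv
  have hsha : padicValNat 3 (W.baseChange K).shaOrder =
      padicValNat 3 (Nat.card (AddCommGroup.primaryComponent (W.baseChange K).sha 3)) :=
    padicValNat_shaOrder_eq (W.baseChange K) 3
  have htam0 : padicValNat 3 W.tamagawaProduct = 0 := padicValNat.eq_zero_of_not_dvd htam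
  -- STEP L reads `2 M₀ ≤ ord₃ #Ш(E/K)[3^∞]`
  have hL' : 2 * M₀ ≤ padicValNat 3 (Nat.card (AddCommGroup.primaryComponent (W.baseChange K).sha 3)) := by
    unfold IndexLowerBoundAt at hL
    rw [hidx, hsha, htam0] at hL
    omega
  -- THE SLICE: `dim_𝔽₃ Sel₃ = 1`, rank one, no 3-torsion ⟹ `Ш(E/K)[3^∞] = 0`
  obtain ⟨s, hs⟩ := exists_natCard_selmerGroup_eq_pow (W.baseChange K) 3
  have hfin : finrank (ZMod 3)
      (AddSubgroup.toZModSubmodule 3 (selmerGroup (W.baseChange K) ((3 ^ 1 : ℕ) : ℤ))) = s :=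
    Method2.finrank_selmer_eq_of_natCard_eq_pow (W.baseChange K) hs
  have hs1 : s = 1 := by rw [← hfin, h1dim]
  have hSel3 : Nat.card ((W.baseChange K).selmerGroup ((3 : ℕ) : ℤ)) = 3 := by
    rw [hs, hs1, pow_one]
  have ht : Nat.card (AddSubgroup.torsionBy (W.baseChange K).toAffine.Point ((3 : ℕ) : ℤ)) = 1 := by
    rw [hbot, AddSubgroup.card_bot]
  have hShabot : AddCommGroup.primaryComponent (W.baseChange K).sha 3 = ⊥ :=
    primaryComponent_sha_eq_bot_of_card_selmerGroup_eq (W.baseChange K) 3 hSel3 hrank ht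
  have hM₀ : M₀ = 0 := by
    have hcard1 : Nat.card (AddCommGroup.primaryComponent (W.baseChange K).sha 3) = 1 := by
      rw [hShabot, AddSubgroup.card_bot]
    rw [hcard1, padicValNat_one_right] at hL'
    omega
  -- hence `y_K ∉ 3E(K)`
  have hndiv1 : ¬ ∃ Q : (W.baseChange K).toAffine.Point, ((3 ^ 1 : ℕ) : ℤ) • Q = P := by
    rw [hM₀, zero_add] at hndiv
    exact hndiv
  -- the conductor-1 datum (Gross 1991 §3) and `P(1) = y_K` (Shimura reciprocity at conductor 1)
  obtain ⟨d₁⟩ := Summit.BirchSwinnertonDyer.BirchSwinnertonDyer.Theorems.nonempty_kolyvaginHeegnerData_of_grossCM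
    h1 h2 hK hH Dt β ι hβ squarefree_one (by simp)
  obtain ⟨P₀, -, hP₀⟩ := heegnerSystem_exists_isHeegnerPoint_map_eq_derivedPoint_one hrec hK hH d₁
  have hP₀P : P₀ = P := KolyvaginBottom.eq_of_map_eq_heegnerPointComplex hrec hK hH d₁ hHβ hP hP₀
  rw [hP₀P] at hP₀
  -- `E(K[1])[3] = 0` ⟹ `P(1) ∉ 3E(K[1])`
  have htor : ∀ R : (W.baseChange (ringClassField K ι 1)).toAffine.Point, ((3 ^ 1 : ℕ) : ℤ) • R = 0 → R = 0 :=
    fun R hR ↦ RingClassNoTorsion.eq_zero_of_zsmul_pow_eq_zero_ringClassField W hK ι one_ne_zero Nat.prime_three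
      (by norm_num) hρ 1 R hR
  have hcert : ¬ PDiv d₁ 3 1 := fun h ↦ hndiv1 ((pDiv_one_iff_exists_zsmul_eq hK d₁ P hP₀ 3 1 htor).mp h)
  -- the tower theorem at conductor 1
  let d : (m : ℕ) → m ∣ 1 → KolyvaginHeegnerData Dt β ι m := fun m hm ↦
    if h : m = 1 then h ▸ d₁ else (h (Nat.dvd_one.mp hm)).elim
  have hd : d 1 dvd_rfl = d₁ := by
    show (if h : (1 : ℕ) = 1 then h ▸ d₁ else _) = d₁
    rw [dif_pos rfl]
  have hcert' : ¬ PDiv (d 1 dvd_rfl) 3 1 := by rwa [hd]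
  have hne := KolyCert.kolyvaginClass_three_ne_zero_of_tower_not_pDiv W K Dt β ι hmult hρ hK hH
    (KolyvaginDescent.kolSupp_one _) d hcert'
  rw [hd] at hne
  exact ⟨d₁, hne⟩

/-! ## §2 A1 ∩ NON-SPLIT(3): the leaf from road (a) + Schneider at the pair -/

/-- **The conductor-one Kolyvagin class mod 3 on the slice `dim_𝔽₃ Sel₃(E/K) = 1` of a NON-SPLIT A1 curve, from the
published inputs and Schneider's non-degeneracy at the pair** — the n = 1 sharpening, on S1's slice, of koly3b g0's
`kolyvaginClass_one_ne_zero_at_hlFrame_of_nonsplit_of_regulatorNonvanishingAt` (p456367). PUBLISHED inputs as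
binders: §1's eight and road (a)'s five (Skinner 2016 Thm. A `hSkA`, Stein–Wuthrich Thm. 6.1 non-split `hJn`, §4.2
height `hHn`, Disegni 2020 Thm. 1 `hD`, parametrisations `hpar`). OPEN input: `ClassClosure.RegulatorNonvanishingAt
W 3` (Schneider at the pair; class-wide on A1 ∩ non-split = `ClassRecordThree.SchneiderAtThree` (19106) restricted
to A1 — NOT the off-A1 residual `SchneiderTamAtThree`). Proof: road (a) gives `BSDp W 3`; then §1. CONDITIONAL on
every binder; nothing is booked. [cite: Skinner2016PacificMC, Thm. A, §3.2] [cite: SteinWuthrich2013, Thm. 6.1]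
[cite: Disegni2020, Thm. 1] [cite: McCallumLMS1991, §5 Lemma 5.1, §4 Cor. 4.5] -/
theorem kolyvaginClass_conductorOne_ne_zero_of_nonsplit_of_regulatorNonvanishingAt
    (W : WeierstrassCurve ℚ) [W.IsElliptic] [W.IsGloballyMinimal] [NeZero (W.conductorNorm ℤ)]
    (K : Type) [Field K] [NumberField K]
    (Dt : ModularParametrizationData W (W.conductorNorm ℤ)) (β : ℤ) (ι : K →+* ℂ)
    -- published inputs: §1's eight
    (hGZ : gross_zagier (W.conductorNorm ℤ) W K) (hKo : kolyvagin (W.conductorNorm ℤ) W K)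
    (hSk : Skinner2016.thmC_padicValRat_bsd_rank_zero)
    (hGZK : rank_eq_analyticRank_of_analyticRank_le_one) (hmod : hasEntireLFunction_rat)
    (hrec : heegnerPointOfConductor_one_galoisConj (W.conductorNorm ℤ) W K)
    (h1 : phi_heegnerPointOfConductor_mem_range_map_ringClassField (W.conductorNorm ℤ) W K)
    (h2 : exists_generator_ringClassGalOver K)
    -- published inputs: road (a)'s five
    (hSkA : thmA_charIdeal_multiplicative) (hJn : thm61_nonsplitMultiplicative) (hHn : exists_isMultCanonical)
    (hD : thm1_padicBSD_rankOne_multiplicative) (hpar : nonempty_modularParametrizationData)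
    -- the pair (A1, non-split at 3) and the HL frame
    (hX : ClassX11b W 3) (hns : ¬ W.HasSplitMultiplicativeReductionAtPrime 3) (hram : Ram W 3)
    (htam : ¬ 3 ∣ W.tamagawaProduct)
    (hK : IsImaginaryQuadratic K) (hodd : Odd (NumberField.discr K))
    (hH : SatisfiesHeegnerHypothesis (W.conductorNorm ℤ) K)
    (hLt : (W.quadraticTwist (NumberField.discr K : ℚ)).entireLFunction 1 ≠ 0)
    (hβ : (4 * (W.conductorNorm ℤ : ℤ)) ∣ β ^ 2 - NumberField.discr K) (hc : ¬ (3 : ℤ) ∣ Dt.c)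
    [Module (ZMod 3) (Method2.V3 W K)]
    (h1dim : finrank (ZMod 3)
      (AddSubgroup.toZModSubmodule 3 (selmerGroup (W.baseChange K) ((3 ^ 1 : ℕ) : ℤ))) = 1)
    -- THE OPEN INPUT: Schneider's non-degeneracy at (E, 3)
    (hReg : ClassClosure.RegulatorNonvanishingAt W 3) :
    ∃ d : KolyvaginHeegnerData Dt β ι 1, d.kolyvaginClass Nat.prime_three 1 ≠ 0 := by
  haveI : Fact (Nat.Prime 3) := ⟨Nat.prime_three⟩
  have hbsd : BSDp W 3 :=
    bsdp_of_ram_of_nonsplit_of_regulatorNonvanishing hSkA hJn hHn hD hGZK hpar W 3 hX hram hns hReg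
  exact kolyvaginClass_conductorOne_ne_zero_of_bsdp_of_finrank_selmer_eq_one W K Dt β ι hGZ hKo hSk hGZK hmod hrec
    h1 h2 hX hram htam hK hodd hH hLt hβ hc h1dim hbsd

end Summit.BirchSwinnertonDyer.Rank1Residual.X11b.Three.Koly

/-! ## §3 The registered stub S1's signature as conclusion shape -/

namespace Summit.BirchSwinnertonDyer.Rank1Residual.X11b.Three.Koly.BottomRankOne

open WeierstrassCurve NumberField Literature.NumberTheory.EllipticCurves
  Literature.NumberTheory.EllipticCurves.ModularForms
  Literature.NumberTheory.EllipticCurves.Rank1Residual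
  Literature.NumberTheory.EllipticCurves.Skinner2016
  Literature.NumberTheory.EllipticCurves.SteinWuthrich2013
  Literature.NumberTheory.EllipticCurves.Disegni2020
  Summit.BirchSwinnertonDyer.Rank1Residual Summit.BirchSwinnertonDyer.Rank1Residual.X11b Module

/-- **Stub S1 `stub_bottomRankOneAtThree` of skeleton v2y FROM «BSD₃ on A1»** (its signature VERBATIM after the
∀-bound published inputs and the leaf hypothesis): granted Gross–Zagier, Kolyvagin, Skinner 2016 Thm. C, GZK,
modularity, Shimura reciprocity at conductor 1 and Gross 1991 §3 ×2, if `BSDp W 3` holds for every globally minimal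
A1 curve then at every HL A1 frame with `dim_𝔽₃ Sel₃(E/K) = 1` some conductor-1 datum has `c₁(1) ≠ 0`. So on S1's
slice the stub carries NO content beyond the leaf of rung K2@3 at the pair — WITHOUT McCallum's structure theorem
(contrast zhang3-p1's `zhangSharpFrameAtThreeHL_of_bsdp_onA1`, which needs Cor. 5.6 and yields an unnamed `n`).
CONDITIONAL on every binder; `BSDp W 3` on A1 is a HYPOTHESIS (the rung's open leaf); nothing is booked.
[cite: WZhang2014, Thm. 9.1 (r = 1) and Remark 5] [cite: McCallumLMS1991, §5 Lemma 5.1] -/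
theorem stub_bottomRankOneAtThree_of_bsdp_onA1
    (hGZ : ∀ (N : ℕ) [NeZero N] (W : WeierstrassCurve ℚ) (K : Type) [Field K] [NumberField K],
      gross_zagier N W K)
    (hKo : ∀ (N : ℕ) [NeZero N] (W : WeierstrassCurve ℚ) (K : Type) [Field K] [NumberField K],
      kolyvagin N W K)
    (hSk : Skinner2016.thmC_padicValRat_bsd_rank_zero)
    (hGZK : rank_eq_analyticRank_of_analyticRank_le_one) (hmod : hasEntireLFunction_rat)
    (hrec : ∀ (N : ℕ) [NeZero N] (W : WeierstrassCurve ℚ) (K : Type) [Field K] [NumberField K],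
      heegnerPointOfConductor_one_galoisConj N W K)
    (h1 : ∀ (N : ℕ) [NeZero N] (W : WeierstrassCurve ℚ) (K : Type) [Field K] [NumberField K],
      phi_heegnerPointOfConductor_mem_range_map_ringClassField N W K)
    (h2 : ∀ (K : Type) [Field K] [NumberField K], exists_generator_ringClassGalOver K)
    (hbsd : ∀ (W : WeierstrassCurve ℚ) [W.IsElliptic] [W.IsGloballyMinimal],
      ClassX11b W 3 → Ram W 3 → ¬ 3 ∣ W.tamagawaProduct → BSDp W 3) :
    ∀ (W : WeierstrassCurve ℚ) [W.IsElliptic] [W.IsGloballyMinimal] [NeZero (W.conductorNorm ℤ)] (K : Type)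
      [Field K] [NumberField K] (Dt : ModularParametrizationData W (W.conductorNorm ℤ)) (β : ℤ) (ι : K →+* ℂ),
      Summit.BirchSwinnertonDyer.Rank1Residual.ClassX11b W 3 → W.HasMultiplicativeReductionAtPrime 3 →
      Rank1Residual.Surj W 3 → Rank1Residual.Ram W 3 → ¬ 3 ∣ W.tamagawaProduct → IsImaginaryQuadratic K →
      Odd (NumberField.discr K) → SatisfiesHeegnerHypothesis (W.conductorNorm ℤ) K →
      (W.quadraticTwist (NumberField.discr K : ℚ)).entireLFunction 1 ≠ 0 → NumberField.discr K ≠ -3 →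
      (4 * (W.conductorNorm ℤ : ℤ)) ∣ β ^ 2 - NumberField.discr K → ¬ (3 : ℤ) ∣ Dt.c →
      ∀ [Module (ZMod 3) (Method2.V3 W K)],
      finrank (ZMod 3)
        (AddSubgroup.toZModSubmodule 3 (selmerGroup (W.baseChange K) ((3 ^ 1 : ℕ) : ℤ))) = 1 →
      ∃ d : KolyvaginHeegnerData Dt β ι 1, d.kolyvaginClass Nat.prime_three 1 ≠ 0 := by
  intro W _ _ _ K _ _ Dt β ι hX _hmult _hsurj hram htam hK hodd hH hLt _h3 hβ hc _ h1dim
  exact kolyvaginClass_conductorOne_ne_zero_of_bsdp_of_finrank_selmer_eq_one W K Dt β ι (hGZ _ W K) (hKo _ W K)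
    hSk hGZK hmod (hrec _ W K) (h1 _ W K) (h2 K) hX hram htam hK hodd hH hLt hβ hc h1dim (hbsd W hX hram htam)

/-- **Stub S1 of skeleton v2y on A1 ∩ NON-SPLIT(3) FROM SCHNEIDER ON A1** (S1's signature VERBATIM after the
∀-bound published inputs, plus `¬ split(3)`, with the one open input «`Reg₃(E) ≠ 0` for every non-split A1 curve» =
`ClassRecordThree.SchneiderAtThree` (item 19106) restricted to A1): road (a) of the class record at every such pair,
then §1. The SPLIT-at-3 half of S1's slice is not touched here. CONDITIONAL on every binder; nothing is booked.
[cite: Skinner2016PacificMC, Thm. A] [cite: SteinWuthrich2013, Thm. 6.1, §4.2] [cite: Disegni2020, Thm. 1]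
[cite: McCallumLMS1991, §5 Lemma 5.1] -/
theorem stub_bottomRankOneAtThree_nonsplit_of_schneider_onA1
    (hGZ : ∀ (N : ℕ) [NeZero N] (W : WeierstrassCurve ℚ) (K : Type) [Field K] [NumberField K],
      gross_zagier N W K)
    (hKo : ∀ (N : ℕ) [NeZero N] (W : WeierstrassCurve ℚ) (K : Type) [Field K] [NumberField K],
      kolyvagin N W K)
    (hSk : Skinner2016.thmC_padicValRat_bsd_rank_zero)
    (hGZK : rank_eq_analyticRank_of_analyticRank_le_one) (hmod : hasEntireLFunction_rat)
    (hrec : ∀ (N : ℕ) [NeZero N] (W : WeierstrassCurve ℚ) (K : Type) [Field K] [NumberField K],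
      heegnerPointOfConductor_one_galoisConj N W K)
    (h1 : ∀ (N : ℕ) [NeZero N] (W : WeierstrassCurve ℚ) (K : Type) [Field K] [NumberField K],
      phi_heegnerPointOfConductor_mem_range_map_ringClassField N W K)
    (h2 : ∀ (K : Type) [Field K] [NumberField K], exists_generator_ringClassGalOver K)
    (hSkA : thmA_charIdeal_multiplicative) (hJn : thm61_nonsplitMultiplicative) (hHn : exists_isMultCanonical)
    (hD : thm1_padicBSD_rankOne_multiplicative) (hpar : nonempty_modularParametrizationData)
    -- the open input: Schneider on A1 ∩ non-split(3)
    (hSch : ∀ (W : WeierstrassCurve ℚ) [W.IsElliptic] [W.IsGloballyMinimal],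
      ClassX11b W 3 → Ram W 3 → ¬ W.HasSplitMultiplicativeReductionAtPrime 3 → ¬ 3 ∣ W.tamagawaProduct →
        ClassClosure.RegulatorNonvanishingAt W 3) :
    ∀ (W : WeierstrassCurve ℚ) [W.IsElliptic] [W.IsGloballyMinimal] [NeZero (W.conductorNorm ℤ)] (K : Type)
      [Field K] [NumberField K] (Dt : ModularParametrizationData W (W.conductorNorm ℤ)) (β : ℤ) (ι : K →+* ℂ),
      Summit.BirchSwinnertonDyer.Rank1Residual.ClassX11b W 3 → W.HasMultiplicativeReductionAtPrime 3 →
      Rank1Residual.Surj W 3 → Rank1Residual.Ram W 3 → ¬ 3 ∣ W.tamagawaProduct → IsImaginaryQuadratic K →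
      Odd (NumberField.discr K) → SatisfiesHeegnerHypothesis (W.conductorNorm ℤ) K →
      (W.quadraticTwist (NumberField.discr K : ℚ)).entireLFunction 1 ≠ 0 → NumberField.discr K ≠ -3 →
      (4 * (W.conductorNorm ℤ : ℤ)) ∣ β ^ 2 - NumberField.discr K → ¬ (3 : ℤ) ∣ Dt.c →
      ¬ W.HasSplitMultiplicativeReductionAtPrime 3 →
      ∀ [Module (ZMod 3) (Method2.V3 W K)],
      finrank (ZMod 3)
        (AddSubgroup.toZModSubmodule 3 (selmerGroup (W.baseChange K) ((3 ^ 1 : ℕ) : ℤ))) = 1 →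
      ∃ d : KolyvaginHeegnerData Dt β ι 1, d.kolyvaginClass Nat.prime_three 1 ≠ 0 := by
  intro W _ _ _ K _ _ Dt β ι hX _hmult _hsurj hram htam hK hodd hH hLt _h3 hβ hc hns _ h1dim
  exact kolyvaginClass_conductorOne_ne_zero_of_nonsplit_of_regulatorNonvanishingAt W K Dt β ι (hGZ _ W K)
    (hKo _ W K) hSk hGZK hmod (hrec _ W K) (h1 _ W K) (h2 K) hSkA hJn hHn hD hpar hX hns hram htam hK hodd hH hLt
    hβ hc h1dim (hSch W hX hram hns htam)

end Summit.BirchSwinnertonDyer.Rank1Residual.X11b.Three.Koly.BottomRankOne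

end
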